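import Literature.Topology.FourManifolds.MMSWPictureRadialCollar
import HarnessLib

/-!
# Radial collars of a planar potential, II: the compression straightening map

Topic `Literature/Topology/FourManifolds`; part of the proof of the named fact
`Literature.Topology.FourManifolds.pictureSurgeryPresentation` (`MMSWPictureSurgery.lean`; Kirby,
*The Topology of 4-Manifolds*, LNM 1374 (1989), Ch. I §2, Lemma 2.1).  Everything here is proved;
no named fact is introduced.

Continuation of `MMSWPictureRadialCollar`.  For the same data (centre `c`, potential `ĝ` with
negative radial derivative on an annulus) and a smooth monotone cutoff `χ` with values in `[0, 1]`
we introduce the **compression profile**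

`F(z, w) = χ(ĝ z) ρ(|w|) + (1 − χ(ĝ z)) |z − c|`, `ρ(m) = m / (2√(1 + m²))`,

interpolating between the distance `|z − c|` from the centre (where `χ = 0`: no compression)
and the thin-tube radius `ρ(|w|)` (where `χ = 1`: the collar of the core circle `w = 0` of the
hypersurface `M̂ = {ĝ + |w|² = 1}` is squeezed onto the punctured thin tube about the centre), and
the **compression straightening map** of the punctured collar `{w ≠ 0}`

`Θᴮ(z, w) = (c + F(z, w) u_c(z), (ĝ z + |w|²) u_0(w))`.

Its first component is the compressed ("virtual") planar point, its second records `|w|`-free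
the direction of `w` scaled by the level.  We prove that the derivative of `Θᴮ` is injective
(`injective_fderiv_thetaB`: the kernel computation reduces, by the kernel lemma of part I applied
to both components, to a `2 × 2` system whose determinant has a sign), that `Θᴮ` is injective on
the punctured collar (`injOn_thetaB`: a monotonicity argument along the level curves), hence has
open image and smooth inverse (`thetaB_straighten`), and we record the elementary properties of
the profile `ρ`.

## References

* R. Kirby, *The Topology of 4-Manifolds*, LNM 1374 (1989), Ch. I §2. [Kirby1989]
* J. M. Lee, *Introduction to Smooth Manifolds*, 2nd ed. (2013), Thm. 4.5. [LeeSmoothManifolds2013]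
-/

open scoped Topology Real ComplexConjugate ContDiff
open Function Set

noncomputable section

namespace Literature.Topology.FourManifolds

namespace MMSW

variable {c z : ℂ} {ĝ : ℂ → ℝ} {χ : ℝ → ℝ} {a₁ a₂ m₀ : ℝ}

/-! ## The thin-tube profile `ρ` -/

/-- **The thin-tube radial profile** `ρ(m) = m/(2√(1 + m²))`, the norm of the tree's
`squeeze ½` applied to a vector of norm `m`. [folklore] -/
def thinRad (m : ℝ) : ℝ := m / (2 * Real.sqrt (1 + m ^ 2))

/-- `ρ(m) ≥ 0` for `m ≥ 0`. [folklore] -/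
theorem thinRad_nonneg {m : ℝ} (hm : 0 ≤ m) : 0 ≤ thinRad m :=
  div_nonneg hm (by have := (Real.sqrt_pos.2 (by positivity) : 0 < Real.sqrt (1 + m ^ 2)); positivity)

/-- `ρ(m) > 0` for `m > 0`. [folklore] -/
theorem thinRad_pos {m : ℝ} (hm : 0 < m) : 0 < thinRad m :=
  div_pos hm (by have := (Real.sqrt_pos.2 (by positivity) : 0 < Real.sqrt (1 + m ^ 2)); positivity)

/-- `ρ(m) < 1/2`. [folklore] -/
theorem thinRad_lt_half (m : ℝ) : thinRad m < 1 / 2 := by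
  have hs := (Real.sqrt_pos.2 (by positivity) : 0 < Real.sqrt (1 + m ^ 2))
  rw [thinRad, div_lt_div_iff₀ (by positivity) (by norm_num)]
  have hlt : m < Real.sqrt (1 + m ^ 2) := by
    refine lt_of_le_of_lt (le_abs_self m) ?_
    rw [← Real.sqrt_sq_eq_abs]
    exact Real.sqrt_lt_sqrt (sq_nonneg m) (by linarith)
  linarith

/-- **The derivative of `ρ`**: `ρ'(m) = 1/(2 (1 + m²) √(1 + m²)) > 0`. [folklore] -/
theorem hasDerivAt_thinRad (m : ℝ) :
    HasDerivAt thinRad (1 / (2 * (1 + m ^ 2) * Real.sqrt (1 + m ^ 2))) m := by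
  have hs := (Real.sqrt_pos.2 (by positivity) : 0 < Real.sqrt (1 + m ^ 2))
  have h1 : HasDerivAt (fun m : ℝ ↦ 1 + m ^ 2) (2 * m) m := by
    simpa using (hasDerivAt_pow 2 m).const_add 1
  have h2 : HasDerivAt (fun m : ℝ ↦ Real.sqrt (1 + m ^ 2)) (2 * m / (2 * Real.sqrt (1 + m ^ 2))) m :=
    h1.sqrt (by positivity)
  have h3 : HasDerivAt (fun m : ℝ ↦ 2 * Real.sqrt (1 + m ^ 2))
      (2 * (2 * m / (2 * Real.sqrt (1 + m ^ 2)))) m := h2.const_mul 2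
  have h4 := (hasDerivAt_id m).div h3 (by positivity)
  have h4' : HasDerivAt (fun m : ℝ ↦ m / (2 * Real.sqrt (1 + m ^ 2))) _ m := h4
  refine h4'.congr_deriv ?_
  have hsq : Real.sqrt (1 + m ^ 2) ^ 2 = 1 + m ^ 2 := Real.sq_sqrt (by positivity)
  simp only [id_eq, one_mul]
  rw [div_eq_div_iff (by positivity) (by positivity)]
  have e1 : 2 * Real.sqrt (1 + m ^ 2) - m * (2 * (2 * m / (2 * Real.sqrt (1 + m ^ 2)))) =
      2 / Real.sqrt (1 + m ^ 2) := by
    field_simp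
    nlinarith [hsq]
  rw [e1]
  field_simp
  nlinarith [hsq]

/-- `ρ' > 0`. [folklore] -/
theorem deriv_thinRad_pos (m : ℝ) : 0 < 1 / (2 * (1 + m ^ 2) * Real.sqrt (1 + m ^ 2)) := by
  have := (Real.sqrt_pos.2 (by positivity) : 0 < Real.sqrt (1 + m ^ 2)); positivity

/-- `ρ` is strictly increasing. [folklore] -/
theorem strictMono_thinRad : StrictMono thinRad :=
  strictMono_of_deriv_pos fun m ↦ by rw [(hasDerivAt_thinRad m).deriv]; exact deriv_thinRad_pos m

/-- `ρ` is continuous. [folklore] -/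
theorem continuous_thinRad : Continuous thinRad := by
  unfold thinRad
  refine continuous_id.div (continuous_const.mul ((continuous_const.add (continuous_id.pow 2)).sqrt))
    fun m ↦ ?_
  have := (Real.sqrt_pos.2 (by positivity) : 0 < Real.sqrt (1 + m ^ 2)); positivity

/-- `ρ` is smooth. [folklore] -/
theorem contDiff_thinRad {n : WithTop ℕ∞} : ContDiff ℝ n thinRad := by
  unfold thinRad
  refine contDiff_id.div (contDiff_const.mul ((contDiff_const.add (contDiff_id.pow 2)).sqrt
    fun m ↦ by positivity)) fun m ↦ ?_
  have := (Real.sqrt_pos.2 (by positivity) : 0 < Real.sqrt (1 + m ^ 2)); positivity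

/-! ## The compression profile and the straightening map `Θᴮ` -/

/-- **The compression profile** `F(z, w) = χ(ĝ z) ρ(|w|) + (1 − χ(ĝ z)) |z − c|`. [folklore] -/
def profF (c : ℂ) (ĝ : ℂ → ℝ) (χ : ℝ → ℝ) (p : ℂ × ℂ) : ℝ :=
  χ (ĝ p.1) * thinRad ‖p.2‖ + (1 - χ (ĝ p.1)) * ‖p.1 - c‖

/-- **The compression straightening map**
`Θᴮ(z, w) = (c + F(z, w) u_c(z), (ĝ z + |w|²) u_0(w))`. [folklore] -/
def thetaB (c : ℂ) (ĝ : ℂ → ℝ) (χ : ℝ → ℝ) (p : ℂ × ℂ) : ℂ × ℂ :=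
  (c + ((profF c ĝ χ p : ℝ) : ℂ) * unitDir c p.1, ((ĝ p.1 + ‖p.2‖ ^ 2 : ℝ) : ℂ) * unitDir 0 p.2)

/-- The profile is a convex combination of `ρ(|w|)` and `|z − c|`; it is positive off the core
(`w ≠ 0`, `z ≠ c`) when `χ ∈ [0, 1]`. [folklore] -/
theorem profF_pos {p : ℂ × ℂ} (hz : p.1 ≠ c) (hw : p.2 ≠ 0) (h0 : 0 ≤ χ (ĝ p.1))
    (h1 : χ (ĝ p.1) ≤ 1) : 0 < profF c ĝ χ p := by
  unfold profF
  have hρ := thinRad_pos (norm_pos_iff.2 hw)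
  have hn := norm_pos_iff.2 (sub_ne_zero.2 hz)
  rcases h1.eq_or_lt with h | h
  · rw [h]; linarith
  · nlinarith

/-- The profile is at most `|z − c|` when `ρ(|w|) ≤ |z − c|` (it compresses inwards). [folklore] -/
theorem profF_le {p : ℂ × ℂ} (h0 : 0 ≤ χ (ĝ p.1)) (hρ : thinRad ‖p.2‖ ≤ ‖p.1 - c‖) :
    profF c ĝ χ p ≤ ‖p.1 - c‖ := by
  unfold profF; nlinarith

/-- Where the cutoff vanishes there is no compression: `F = |z − c|`. [folklore] -/
theorem profF_of_eq_zero {p : ℂ × ℂ} (h : χ (ĝ p.1) = 0) : profF c ĝ χ p = ‖p.1 - c‖ := by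
  simp [profF, h]

/-- Where the cutoff is `1` the profile is the thin-tube radius: `F = ρ(|w|)`. [folklore] -/
theorem profF_of_eq_one {p : ℂ × ℂ} (h : χ (ĝ p.1) = 1) : profF c ĝ χ p = thinRad ‖p.2‖ := by
  simp [profF, h]

/-- Where the cutoff vanishes `Θᴮ(z, w) = (z, (ĝ z + |w|²) u_0(w))`. [folklore] -/
theorem thetaB_fst_of_eq_zero {p : ℂ × ℂ} (h : χ (ĝ p.1) = 0) : (thetaB c ĝ χ p).1 = p.1 := by
  rw [thetaB, profF_of_eq_zero h, norm_mul_unitDir, add_sub_cancel]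

/-- The norm of the second component of `Θᴮ` is the level `ĝ + |w|²` (when nonnegative, `w ≠ 0`).
[folklore] -/
theorem norm_thetaB_snd {p : ℂ × ℂ} (hw : p.2 ≠ 0) (hG : 0 ≤ ĝ p.1 + ‖p.2‖ ^ 2) :
    ‖(thetaB c ĝ χ p).2‖ = ĝ p.1 + ‖p.2‖ ^ 2 := by
  rw [thetaB, norm_mul, Complex.norm_real, Real.norm_of_nonneg hG, norm_unitDir (by simpa using hw),
    mul_one]

/-- The distance of the first component of `Θᴮ` from the centre is the profile. [folklore] -/
theorem norm_thetaB_fst_sub {p : ℂ × ℂ} (hz : p.1 ≠ c) (hF : 0 ≤ profF c ĝ χ p) :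
    ‖(thetaB c ĝ χ p).1 - c‖ = profF c ĝ χ p := by
  rw [thetaB, add_sub_cancel_left, norm_mul, Complex.norm_real, Real.norm_of_nonneg hF,
    norm_unitDir hz, mul_one]

/-- On the level hypersurface the second component of `Θᴮ` is the direction of `w`. [folklore] -/
theorem thetaB_snd_of_level {p : ℂ × ℂ} (h : ĝ p.1 + ‖p.2‖ ^ 2 = 1) :
    (thetaB c ĝ χ p).2 = unitDir 0 p.2 := by
  simp [thetaB, h]

/-- `Θᴮ` is smooth on the punctured collar (`z ≠ c`, `w ≠ 0`, `ĝ` smooth at `z`, `χ` smooth).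
[folklore] -/
theorem contDiffAt_thetaB {p : ℂ × ℂ} (hz : p.1 ≠ c) (hw : p.2 ≠ 0) (hg : ContDiffAt ℝ ∞ ĝ p.1)
    (hχ : ContDiff ℝ ∞ χ) : ContDiffAt ℝ ∞ (thetaB c ĝ χ) p := by
  have hg1 : ContDiffAt ℝ ∞ (fun p : ℂ × ℂ ↦ ĝ p.1) p := hg.comp p contDiffAt_fst
  have hχg : ContDiffAt ℝ ∞ (fun p : ℂ × ℂ ↦ χ (ĝ p.1)) p := hχ.contDiffAt.comp p hg1
  have hnw : ContDiffAt ℝ ∞ (fun p : ℂ × ℂ ↦ ‖p.2‖) p := contDiffAt_snd.norm ℝ hw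
  have hnz : ContDiffAt ℝ ∞ (fun p : ℂ × ℂ ↦ ‖p.1 - c‖) p :=
    (contDiffAt_fst.sub contDiffAt_const).norm ℝ (sub_ne_zero.2 hz)
  have hF : ContDiffAt ℝ ∞ (profF c ĝ χ) p := by
    unfold profF
    exact (hχg.mul (contDiff_thinRad.contDiffAt.comp p hnw)).add ((contDiffAt_const.sub hχg).mul hnz)
  have hu1 : ContDiffAt ℝ ∞ (fun p : ℂ × ℂ ↦ unitDir c p.1) p :=
    (contDiffAt_unitDir hz).comp p contDiffAt_fst
  have hu2 : ContDiffAt ℝ ∞ (fun p : ℂ × ℂ ↦ unitDir 0 p.2) p :=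
    (contDiffAt_unitDir (by simpa using hw)).comp p contDiffAt_snd
  have hG : ContDiffAt ℝ ∞ (fun p : ℂ × ℂ ↦ ĝ p.1 + ‖p.2‖ ^ 2) p :=
    hg1.add ((contDiffAt_snd (𝕜 := ℝ)).norm_sq ℝ)
  exact (contDiffAt_const.add ((Complex.ofRealCLM.contDiff.comp_contDiffAt p hF).mul hu1)).prodMk
    ((Complex.ofRealCLM.contDiff.comp_contDiffAt p hG).mul hu2)

/-! ## The kernel of the derivative of `Θᴮ` -/
set_option maxHeartbeats 400000 in -- buildfix (bf3-g27): 160k/180k FAIL, 200k PASS at accept time; line-neutral budget line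
/-- **The derivative of `Θᴮ` is injective** at a point `(z, w)` of the punctured collar where the
radial derivative `d` of `ĝ` is negative, `χ' ≥ 0`, `0 ≤ χ ≤ 1`, `ρ' > 0` and `ρ(|w|) < |z − c|`.
[folklore] -/
theorem injective_fderiv_thetaB {w : ℂ} (hz : z ≠ c) (hw : w ≠ 0) (hG : 0 < ĝ z + ‖w‖ ^ 2)
    {ĝ' : ℂ →L[ℝ] ℝ} (hĝ : HasFDerivAt ĝ ĝ' z) {d : ℝ} (hdneg : d < 0)
    (hd : HasDerivAt (fun r : ℝ ↦ ĝ (c + (r : ℂ) * unitDir c z)) d ‖z - c‖)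
    {χ' : ℝ} (hχ : HasDerivAt χ χ' (ĝ z)) (hχ' : 0 ≤ χ') (hχ0 : 0 ≤ χ (ĝ z)) (hχ1 : χ (ĝ z) ≤ 1)
    (hρ : thinRad ‖w‖ < ‖z - c‖) (hdiff : DifferentiableAt ℝ (thetaB c ĝ χ) (z, w)) :
    Injective (fderiv ℝ (thetaB c ĝ χ) (z, w)) := by
  refine injective_of_hasDerivAt_line hdiff.hasFDerivAt fun v hv ↦ ?_
  obtain ⟨B, D⟩ := v
  set A : ℂ := z - c with hA
  have hA0 : A ≠ 0 := sub_ne_zero.2 hz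
  set n : ℝ := ‖A‖ with hn
  set m : ℝ := ‖w‖ with hm
  have hn0 : 0 < n := norm_pos_iff.2 hA0
  have hm0 : 0 < m := norm_pos_iff.2 hw
  have hF : 0 < profF c ĝ χ (z, w) := profF_pos (p := (z, w)) hz hw hχ0 hχ1
  -- lines
  have hlineZ : ∀ t : ℝ, ((z, w) + t • (B, D)).1 = z + (t : ℂ) * B := fun t ↦ by
    simp [Complex.real_smul]
  have hlineW : ∀ t : ℝ, ((z, w) + t • (B, D)).2 = w + (t : ℂ) * D := fun t ↦ by
    simp [Complex.real_smul]
  have hzline : ∀ t : ℝ, z + (t : ℂ) * B - c = A + (t : ℂ) * B := fun t ↦ by rw [hA]; ring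
  -- elementary derivatives along the line
  have hN : HasDerivAt (fun t : ℝ ↦ ‖A + (t : ℂ) * B‖) ((B * conj A).re / n) 0 :=
    hasDerivAt_norm_line hA0 B
  have hM : HasDerivAt (fun t : ℝ ↦ ‖w + (t : ℂ) * D‖) ((D * conj w).re / m) 0 :=
    hasDerivAt_norm_line hw D
  have hγ : HasDerivAt (fun t : ℝ ↦ ĝ (z + (t : ℂ) * B)) (ĝ' B) 0 := by
    have := hasDerivAt_comp_line hĝ B
    simpa [Complex.real_smul] using this
  have hχγ : HasDerivAt (fun t : ℝ ↦ χ (ĝ (z + (t : ℂ) * B))) (χ' * ĝ' B) 0 := by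
    have hχ0 : HasDerivAt χ χ' (ĝ (z + ((0 : ℝ) : ℂ) * B)) := by simpa using hχ
    exact hχ0.comp 0 hγ
  have hρM : HasDerivAt (fun t : ℝ ↦ thinRad ‖w + (t : ℂ) * D‖)
      (1 / (2 * (1 + m ^ 2) * Real.sqrt (1 + m ^ 2)) * ((D * conj w).re / m)) 0 := by
    have hρ0 : HasDerivAt thinRad (1 / (2 * (1 + m ^ 2) * Real.sqrt (1 + m ^ 2)))
        ‖w + ((0 : ℝ) : ℂ) * D‖ := by simpa [hm] using hasDerivAt_thinRad m
    exact hρ0.comp 0 hM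
  set ρ' : ℝ := 1 / (2 * (1 + m ^ 2) * Real.sqrt (1 + m ^ 2)) with hρ'
  have hρ'pos : 0 < ρ' := deriv_thinRad_pos m
  -- the profile along the line
  set F' : ℝ := (χ' * ĝ' B) * thinRad m + χ (ĝ z) * (ρ' * ((D * conj w).re / m)) +
    (-(χ' * ĝ' B) * n + (1 - χ (ĝ z)) * ((B * conj A).re / n)) with hF'
  have hFd : HasDerivAt (fun t : ℝ ↦ profF c ĝ χ ((z, w) + t • (B, D))) F' 0 := by
    have h1 := (hχγ.fun_mul hρM).fun_add ((hχγ.const_sub 1).fun_mul hN)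
    have hfun : (fun t : ℝ ↦ profF c ĝ χ ((z, w) + t • (B, D))) = fun t : ℝ ↦
        χ (ĝ (z + (t : ℂ) * B)) * thinRad ‖w + (t : ℂ) * D‖ +
          (1 - χ (ĝ (z + (t : ℂ) * B))) * ‖A + (t : ℂ) * B‖ := by
      funext t; simp only [profF, hlineZ, hlineW, hzline]
    rw [hfun]
    refine h1.congr_deriv ?_
    simp only [Complex.ofReal_zero, zero_mul, add_zero, hF', ← hm, ← hn]
  -- the level along the line
  have hGd : HasDerivAt (fun t : ℝ ↦ ĝ (z + (t : ℂ) * B) + ‖w + (t : ℂ) * D‖ ^ 2)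
      (ĝ' B + 2 * (D * conj w).re) 0 := by
    have hl : HasDerivAt (fun t : ℝ ↦ w + (t : ℂ) * D) D 0 := by
      have := ((hasDerivAt_id (0 : ℝ)).ofReal_comp.mul_const D).const_add w
      simpa using this
    have h2 : HasDerivAt (fun t : ℝ ↦ ‖w + (t : ℂ) * D‖ ^ 2) (2 * inner ℝ (w + ((0 : ℝ) : ℂ) * D) D) 0 :=
      hl.norm_sq
    simp only [Complex.ofReal_zero, zero_mul, add_zero, Complex.inner] at h2
    exact hγ.add h2
  -- the two components of `Θᴮ` along the line
  have hU1 := hasDerivAt_unitDir_line hz B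
  have hU2 := hasDerivAt_unitDir_line (c := 0) (z := w) (by simpa using hw) D
  simp only [sub_zero] at hU2
  have hfst : HasDerivAt (fun t : ℝ ↦ (thetaB c ĝ χ ((z, w) + t • (B, D))).1)
      ((F' : ℂ) * (((n⁻¹ : ℝ) : ℂ) * A) +
        ((profF c ĝ χ (z, w) : ℝ) : ℂ) *
          (((n⁻¹ : ℝ) : ℂ) * B - (((B * conj A).re / n ^ 3 : ℝ) : ℂ) * A)) 0 := by
    have hfun : (fun t : ℝ ↦ (thetaB c ĝ χ ((z, w) + t • (B, D))).1) = fun t : ℝ ↦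
        c + ((profF c ĝ χ ((z, w) + t • (B, D)) : ℝ) : ℂ) * unitDir c (z + (t : ℂ) * B) := by
      funext t; simp only [thetaB, hlineZ]
    rw [hfun]
    have h := (hFd.ofReal_comp.fun_mul hU1).const_add c
    refine h.congr_deriv ?_
    simp only [zero_smul, add_zero, Complex.ofReal_zero, zero_mul, ← hA, ← hn]
    rw [show unitDir c z = ((n⁻¹ : ℝ) : ℂ) * A by rw [unitDir, hA]]
  have hsnd : HasDerivAt (fun t : ℝ ↦ (thetaB c ĝ χ ((z, w) + t • (B, D))).2)
      (((ĝ' B + 2 * (D * conj w).re : ℝ) : ℂ) * (((m⁻¹ : ℝ) : ℂ) * w) +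
        ((ĝ z + ‖w‖ ^ 2 : ℝ) : ℂ) *
          (((m⁻¹ : ℝ) : ℂ) * D - (((D * conj w).re / m ^ 3 : ℝ) : ℂ) * w)) 0 := by
    have hfun : (fun t : ℝ ↦ (thetaB c ĝ χ ((z, w) + t • (B, D))).2) = fun t : ℝ ↦
        ((ĝ (z + (t : ℂ) * B) + ‖w + (t : ℂ) * D‖ ^ 2 : ℝ) : ℂ) * unitDir 0 (w + (t : ℂ) * D) := by
      funext t; simp only [thetaB, hlineZ, hlineW]
    rw [hfun]
    have h := hGd.ofReal_comp.fun_mul hU2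
    refine h.congr_deriv ?_
    simp only [Complex.ofReal_zero, zero_mul, add_zero, ← hm]
    rw [show unitDir 0 w = ((m⁻¹ : ℝ) : ℂ) * w by rw [unitDir, sub_zero, hm]]
  -- compare with the vanishing derivative
  have hboth := hfst.prodMk hsnd
  have hfun : (fun t : ℝ ↦ ((thetaB c ĝ χ ((z, w) + t • (B, D))).1,
      (thetaB c ĝ χ ((z, w) + t • (B, D))).2)) = fun t : ℝ ↦ thetaB c ĝ χ ((z, w) + t • (B, D)) :=
    funext fun t ↦ Prod.mk.eta
  rw [hfun] at hboth
  have heq := hboth.unique hv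
  rw [Prod.ext_iff] at heq
  obtain ⟨h1, h2⟩ := heq
  simp only [Prod.fst_zero, Prod.snd_zero] at h1 h2
  -- kernel lemma on both components
  obtain ⟨hF'0, hB⟩ := kernel_radial hA0 hF.ne' h1
  obtain ⟨hG'0, hD⟩ := kernel_radial hw hG.ne' h2
  -- the radial coefficients
  set lam : ℝ := (B * conj A).re / n ^ 2 with hlam
  set mu : ℝ := (D * conj w).re / m ^ 2 with hmu
  have hpAB : (B * conj A).re = lam * n ^ 2 := by rw [hlam]; field_simp
  have hpwD : (D * conj w).re = mu * m ^ 2 := by rw [hmu]; field_simp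
  have hĝB : ĝ' B = lam * (n * d) := by
    have e1 : B = lam • A := by rw [Complex.real_smul]; exact hB
    rw [e1, map_smul, smul_eq_mul, fderiv_apply_sub_centre hĝ hd]
  -- the two scalar equations
  have eqG : lam * n * d + 2 * mu * m ^ 2 = 0 := by
    have := hG'0; rw [hĝB, hpwD] at this; linear_combination this
  have eqF : lam * n * (χ' * d * (thinRad m - n) + (1 - χ (ĝ z))) + mu * m * (χ (ĝ z) * ρ') = 0 := by
    have := hF'0
    rw [hF', hĝB, hpwD, hpAB] at this
    have e1 : mu * m ^ 2 / m = mu * m := by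
      rw [pow_two, ← mul_assoc, mul_div_cancel_right₀ _ hm0.ne']
    have e2 : lam * n ^ 2 / n = lam * n := by
      rw [pow_two, ← mul_assoc, mul_div_cancel_right₀ _ hn0.ne']
    rw [e1, e2] at this
    linear_combination this
  -- sign analysis: `mu = 0`, then `lam = 0`
  have ha : 0 ≤ χ' * d * (thinRad m - n) + (1 - χ (ĝ z)) := by
    have : 0 ≤ χ' * (d * (thinRad m - n)) := mul_nonneg hχ' (by nlinarith)
    nlinarith
  have hb : 0 ≤ χ (ĝ z) * ρ' := mul_nonneg hχ0 hρ'pos.le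
  set a : ℝ := χ' * d * (thinRad m - n) + (1 - χ (ĝ z)) with hadef
  set b : ℝ := χ (ĝ z) * ρ' with hbdef
  have hmu0 : mu = 0 := by
    by_contra hne
    -- eliminate `lam`: `d · eqF − a · eqG`
    have key : mu * m * (b * d - 2 * m * a) = 0 := by linear_combination d * eqF - a * eqG
    have hneg : b * d - 2 * m * a < 0 := by
      have hbd : b * d ≤ 0 := mul_nonpos_of_nonneg_of_nonpos hb hdneg.le
      have hma : 0 ≤ 2 * m * a := by positivity
      rcases hχ1.eq_or_lt with h | h
      · -- `χ = 1`: the first term is negative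
        have : b * d < 0 := by
          rw [hbdef, h, one_mul]; exact mul_neg_of_pos_of_neg hρ'pos hdneg
        linarith
      · -- `χ < 1`: the second term is negative
        have hapos : 0 < a := by
          have : 0 ≤ χ' * (d * (thinRad m - n)) := mul_nonneg hχ' (by nlinarith)
          rw [hadef]; nlinarith
        have : 0 < 2 * m * a := by positivity
        linarith
    have : mu * m ≠ 0 := mul_ne_zero hne hm0.ne'
    exact absurd (mul_eq_zero.1 key) (not_or.2 ⟨this, hneg.ne⟩)
  have hlam0 : lam = 0 := by
    rw [hmu0] at eqG
    have : lam * (n * d) = 0 := by linear_combination eqG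
    rcases mul_eq_zero.1 this with h | h
    · exact h
    · exact absurd h (mul_ne_zero hn0.ne' hdneg.ne)
  rw [hB, hD, hlam0, hmu0]
  simp

/-! ## Injectivity of `Θᴮ` on the punctured collar -/

/-- The punctured collar `{a₁ < |z − c| < a₂} × {0 < |w| < m₀}`. [folklore] -/
def collarB (c : ℂ) (a₁ a₂ m₀ : ℝ) : Set (ℂ × ℂ) :=
  {p | p.1 ∈ annulus c a₁ a₂ ∧ p.2 ≠ 0 ∧ ‖p.2‖ < m₀}

/-- The punctured collar is open. [folklore] -/
theorem isOpen_collarB (c : ℂ) (a₁ a₂ m₀ : ℝ) : IsOpen (collarB c a₁ a₂ m₀) :=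
  ((isOpen_annulus c a₁ a₂).preimage continuous_fst).inter
    ((isOpen_ne_fun continuous_snd continuous_const).inter
      (isOpen_lt (continuous_norm.comp continuous_snd) continuous_const))

/-- The elementary inequality behind the injectivity of `Θᴮ`: with `χ_b ≤ χ_a` in `[0, 1]`,
`ρ_a < ρ_b`, `n < n'` and `ρ_a < n`, the profile increases. [folklore] -/
theorem profF_lt_aux {χa χb ρa ρb n n' : ℝ} (hχ : χb ≤ χa) (hχb0 : 0 ≤ χb) (hχa1 : χa ≤ 1)
    (hρ : ρa < ρb) (hn : n < n') (hρn : ρa < n) :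
    χa * ρa + (1 - χa) * n < χb * ρb + (1 - χb) * n' := by
  have h1 : 0 ≤ χb * (ρb - ρa) := mul_nonneg hχb0 (by linarith)
  have h2 : 0 ≤ (1 - χb) * (n' - n) := mul_nonneg (by linarith) (by linarith)
  have h3 : 0 ≤ (χa - χb) * (n - ρa) := mul_nonneg (by linarith) (by linarith)
  rcases hχb0.eq_or_lt with h | h
  · rw [← h] at h2 ⊢
    nlinarith
  · have h1' : 0 < χb * (ρb - ρa) := mul_pos h (by linarith)
    nlinarith

/-- **`Θᴮ` is injective on the punctured collar** (`a₁ ≥ 1/2` so that `ρ < a₁`, `χ` monotone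
with values in `[0, 1]`, `ĝ` positive and radially strictly decreasing). [folklore] -/
theorem injOn_thetaB (ha : 1 / 2 ≤ a₁) (hχm : Monotone χ) (hχ0 : ∀ x, 0 ≤ χ x) (hχ1 : ∀ x, χ x ≤ 1)
    (hgp : ∀ z ∈ annulus c a₁ a₂, 0 < ĝ z)
    (hrad : ∀ v : ℂ, ‖v‖ = 1 → ∀ r, a₁ < r → r < a₂ →
      ∃ d < 0, HasDerivAt (fun r : ℝ ↦ ĝ (c + (r : ℂ) * v)) d r) :
    InjOn (thetaB c ĝ χ) {p : ℂ × ℂ | p.1 ∈ annulus c a₁ a₂ ∧ p.2 ≠ 0} := by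
  rintro ⟨z, w⟩ ⟨hz, hw⟩ ⟨z', w'⟩ ⟨hz', hw'⟩ h
  simp only at hz hw hz' hw'
  have ha0 : (0 : ℝ) ≤ a₁ := by linarith
  have hzc : z ≠ c := ne_centre_of_mem_annulus ha0 hz
  have hzc' : z' ≠ c := ne_centre_of_mem_annulus ha0 hz'
  have hG : 0 < ĝ z + ‖w‖ ^ 2 := by have := hgp z hz; positivity
  have hG' : 0 < ĝ z' + ‖w'‖ ^ 2 := by have := hgp z' hz'; positivity
  have hF : 0 < profF c ĝ χ (z, w) := profF_pos (p := (z, w)) hzc hw (hχ0 _) (hχ1 _)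
  have hF' : 0 < profF c ĝ χ (z', w') := profF_pos (p := (z', w')) hzc' hw' (hχ0 _) (hχ1 _)
  simp only [thetaB, Prod.mk.injEq, add_right_inj] at h
  obtain ⟨h1, h2⟩ := h
  -- second components: same level, same direction of `w`
  have hn2 := congrArg (fun X : ℂ ↦ ‖X‖) h2
  simp only [norm_mul, Complex.norm_real, Real.norm_of_nonneg hG.le, Real.norm_of_nonneg hG'.le,
    norm_unitDir (show w ≠ 0 from hw), norm_unitDir (show w' ≠ 0 from hw'), mul_one] at hn2
  have hu2 : unitDir 0 w = unitDir 0 w' := by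
    rw [hn2] at h2; exact mul_left_cancel₀ (by exact_mod_cast hG'.ne') h2
  -- first components: same profile, same direction of `z - c`
  have hn1 := congrArg (fun X : ℂ ↦ ‖X‖) h1
  simp only [norm_mul, Complex.norm_real, Real.norm_of_nonneg hF.le, Real.norm_of_nonneg hF'.le,
    norm_unitDir hzc, norm_unitDir hzc', mul_one] at hn1
  have hu1 : unitDir c z = unitDir c z' := by
    rw [hn1] at h1; exact mul_left_cancel₀ (by exact_mod_cast hF'.ne') h1
  -- along the common ray
  have hvn : ‖unitDir c z'‖ = 1 := norm_unitDir hzc'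
  have hzr : z = c + ((‖z - c‖ : ℝ) : ℂ) * unitDir c z' := by
    rw [← hu1]; exact eq_centre_add_norm_mul_unitDir c z
  have hzr' : z' = c + ((‖z' - c‖ : ℝ) : ℂ) * unitDir c z' := eq_centre_add_norm_mul_unitDir c z'
  have hmono := strictAntiOn_ray hrad hvn
  have hρlt : ∀ m : ℝ, thinRad m < ‖z - c‖ := fun m ↦ by linarith [thinRad_lt_half m, hz.1]
  have hρlt' : ∀ m : ℝ, thinRad m < ‖z' - c‖ := fun m ↦ by linarith [thinRad_lt_half m, hz'.1]
  -- the radii agree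
  have hr : ‖z - c‖ = ‖z' - c‖ := by
    by_contra hne
    rcases lt_or_gt_of_ne hne with hlt | hlt
    · -- `n < n'`: then `ĝ z > ĝ z'`, `|w| < |w'|`, and the profile strictly increases
      have hg : ĝ z' < ĝ z := by
        have := hmono hz hz' hlt
        simp only at this
        rwa [← hzr, ← hzr'] at this
      have hm : ‖w‖ < ‖w'‖ := by nlinarith [norm_nonneg w, norm_nonneg w']
      have := profF_lt_aux (hχm hg.le) (hχ0 _) (hχ1 _) (strictMono_thinRad hm) hlt (hρlt ‖w‖)
      simp only [profF] at hn1
      linarith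
    · have hg : ĝ z < ĝ z' := by
        have := hmono hz' hz hlt
        simp only at this
        rwa [← hzr, ← hzr'] at this
      have hm : ‖w'‖ < ‖w‖ := by nlinarith [norm_nonneg w, norm_nonneg w']
      have := profF_lt_aux (hχm hg.le) (hχ0 _) (hχ1 _) (strictMono_thinRad hm) hlt (hρlt' ‖w'‖)
      simp only [profF] at hn1
      linarith
  have hzz : z = z' :=
    calc z = c + ((‖z - c‖ : ℝ) : ℂ) * unitDir c z' := hzr
      _ = c + ((‖z' - c‖ : ℝ) : ℂ) * unitDir c z' := by rw [hr]
      _ = z' := hzr'.symm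
  subst hzz
  -- the norms of `w` agree, hence `w = w'`
  have hww : ‖w‖ = ‖w'‖ := by nlinarith [norm_nonneg w, norm_nonneg w']
  have hw1 : w = ((‖w - 0‖ : ℝ) : ℂ) * unitDir 0 w := by rw [norm_mul_unitDir, sub_zero]
  have hw2 : w' = ((‖w' - 0‖ : ℝ) : ℂ) * unitDir 0 w' := by rw [norm_mul_unitDir, sub_zero]
  rw [sub_zero] at hw1 hw2
  rw [hw1, hw2, hww, hu2]

/-- A smooth function with nonnegative derivative is monotone. [folklore] -/
theorem monotone_of_contDiff_of_deriv_nonneg (hχs : ContDiff ℝ ∞ χ) (hχd : ∀ x, 0 ≤ deriv χ x) :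
    Monotone χ :=
  monotone_of_deriv_nonneg (hχs.differentiable (by simp)) hχd

/-- **The derivative of `Θᴮ` is injective on the punctured collar.** [folklore] -/
theorem injective_fderiv_thetaB_of_mem (ha : 1 / 2 ≤ a₁)
    (hsm : ∀ z ∈ annulus c a₁ a₂, ContDiffAt ℝ ∞ ĝ z)
    (hgp : ∀ z ∈ annulus c a₁ a₂, 0 < ĝ z)
    (hrad : ∀ v : ℂ, ‖v‖ = 1 → ∀ r, a₁ < r → r < a₂ →
      ∃ d < 0, HasDerivAt (fun r : ℝ ↦ ĝ (c + (r : ℂ) * v)) d r)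
    (hχs : ContDiff ℝ ∞ χ) (hχd : ∀ x, 0 ≤ deriv χ x) (hχ0 : ∀ x, 0 ≤ χ x) (hχ1 : ∀ x, χ x ≤ 1)
    {p : ℂ × ℂ} (hp : p.1 ∈ annulus c a₁ a₂) (hw : p.2 ≠ 0) :
    Injective (fderiv ℝ (thetaB c ĝ χ) p) := by
  obtain ⟨z, w⟩ := p
  simp only at hp hw
  have ha0 : (0 : ℝ) ≤ a₁ := by linarith
  have hzc : z ≠ c := ne_centre_of_mem_annulus ha0 hp
  have hG : 0 < ĝ z + ‖w‖ ^ 2 := by have := hgp z hp; positivity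
  have hĝ : HasFDerivAt ĝ (fderiv ℝ ĝ z) z := ((hsm z hp).differentiableAt (by simp)).hasFDerivAt
  obtain ⟨d, hdneg, hd⟩ := hrad (unitDir c z) (norm_unitDir hzc) ‖z - c‖ hp.1 hp.2
  have hχ : HasDerivAt χ (deriv χ (ĝ z)) (ĝ z) :=
    ((hχs.differentiable (by simp)) (ĝ z)).hasDerivAt
  have hρ : thinRad ‖w‖ < ‖z - c‖ := by linarith [thinRad_lt_half ‖w‖, hp.1]
  have hdiff : DifferentiableAt ℝ (thetaB c ĝ χ) (z, w) :=
    (contDiffAt_thetaB (p := (z, w)) hzc hw (hsm z hp) hχs).differentiableAt (by simp)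
  exact injective_fderiv_thetaB hzc hw hG hĝ hdneg hd hχ (hχd _) (hχ0 _) (hχ1 _) hρ hdiff

/-- **The compression straightening theorem**: `Θᴮ` maps the punctured collar onto an OPEN set,
with a smooth inverse. [cite: LeeSmoothManifolds2013, Thm. 4.5] -/
theorem thetaB_straighten (ha : 1 / 2 ≤ a₁)
    (hsm : ∀ z ∈ annulus c a₁ a₂, ContDiffAt ℝ ∞ ĝ z)
    (hgp : ∀ z ∈ annulus c a₁ a₂, 0 < ĝ z)
    (hrad : ∀ v : ℂ, ‖v‖ = 1 → ∀ r, a₁ < r → r < a₂ →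
      ∃ d < 0, HasDerivAt (fun r : ℝ ↦ ĝ (c + (r : ℂ) * v)) d r)
    (hχs : ContDiff ℝ ∞ χ) (hχd : ∀ x, 0 ≤ deriv χ x) (hχ0 : ∀ x, 0 ≤ χ x) (hχ1 : ∀ x, χ x ≤ 1)
    (m₀ : ℝ) :
    IsOpen (thetaB c ĝ χ '' collarB c a₁ a₂ m₀) ∧
      ContDiffOn ℝ ∞ (invFunOn (thetaB c ĝ χ) (collarB c a₁ a₂ m₀))
        (thetaB c ĝ χ '' collarB c a₁ a₂ m₀) := by
  have ha0 : (0 : ℝ) ≤ a₁ := by linarith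
  refine isOpen_image_and_contDiffOn_invFunOn (isOpen_collarB c a₁ a₂ m₀) ?_ ?_ ?_
  · exact fun p hp ↦ (contDiffAt_thetaB (ne_centre_of_mem_annulus ha0 hp.1) hp.2.1
      (hsm p.1 hp.1) hχs).contDiffWithinAt
  · exact (injOn_thetaB ha (monotone_of_contDiff_of_deriv_nonneg hχs hχd) hχ0 hχ1 hgp hrad).mono
      fun p (hp : p ∈ collarB c a₁ a₂ m₀) ↦ (⟨hp.1, hp.2.1⟩ : p.1 ∈ annulus c a₁ a₂ ∧ p.2 ≠ 0)
  · exact fun p hp ↦ injective_fderiv_thetaB_of_mem ha hsm hgp hrad hχs hχd hχ0 hχ1 hp.1 hp.2.1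

/-- The inverse returns to the punctured collar. [folklore] -/
theorem invFunOn_thetaB_mem {q : ℂ × ℂ} (hq : q ∈ thetaB c ĝ χ '' collarB c a₁ a₂ m₀) :
    invFunOn (thetaB c ĝ χ) (collarB c a₁ a₂ m₀) q ∈ collarB c a₁ a₂ m₀ :=
  invFunOn_mem (by simpa [mem_image] using hq)

/-- `Θᴮ ∘ (Θᴮ)⁻¹ = id` on the image. [folklore] -/
theorem thetaB_invFunOn {q : ℂ × ℂ} (hq : q ∈ thetaB c ĝ χ '' collarB c a₁ a₂ m₀) :
    thetaB c ĝ χ (invFunOn (thetaB c ĝ χ) (collarB c a₁ a₂ m₀) q) = q :=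
  invFunOn_eq (by simpa [mem_image] using hq)

/-- `(Θᴮ)⁻¹ ∘ Θᴮ = id` on the punctured collar. [folklore] -/
theorem invFunOn_thetaB (ha : 1 / 2 ≤ a₁) (hχm : Monotone χ) (hχ0 : ∀ x, 0 ≤ χ x)
    (hχ1 : ∀ x, χ x ≤ 1) (hgp : ∀ z ∈ annulus c a₁ a₂, 0 < ĝ z)
    (hrad : ∀ v : ℂ, ‖v‖ = 1 → ∀ r, a₁ < r → r < a₂ →
      ∃ d < 0, HasDerivAt (fun r : ℝ ↦ ĝ (c + (r : ℂ) * v)) d r)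
    {p : ℂ × ℂ} (hp : p ∈ collarB c a₁ a₂ m₀) :
    invFunOn (thetaB c ĝ χ) (collarB c a₁ a₂ m₀) (thetaB c ĝ χ p) = p :=
  ((injOn_thetaB ha hχm hχ0 hχ1 hgp hrad).mono fun q (hq : q ∈ collarB c a₁ a₂ m₀) ↦
    (⟨hq.1, hq.2.1⟩ : q.1 ∈ annulus c a₁ a₂ ∧ q.2 ≠ 0)).leftInvOn_invFunOn hp

/-! ## The level hypersurface along a ray: the compression sweep -/

/-- **The point of the level hypersurface over `c + n v` in the `w`-direction `e`**:
`(c + n v, √(1 − ĝ(c + n v)) e)`. [folklore] -/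
def rayPt (c : ℂ) (ĝ : ℂ → ℝ) (v e : ℂ) (n : ℝ) : ℂ × ℂ :=
  (c + (n : ℂ) * v, ((Real.sqrt (1 - ĝ (c + (n : ℂ) * v)) : ℝ) : ℂ) * e)

/-- The ray point lies on the level hypersurface when `ĝ ≤ 1` there (`|e| = 1`). [folklore] -/
theorem level_rayPt {v e : ℂ} (he : ‖e‖ = 1) {n : ℝ} (hg : ĝ (c + (n : ℂ) * v) ≤ 1) :
    ĝ (rayPt c ĝ v e n).1 + ‖(rayPt c ĝ v e n).2‖ ^ 2 = 1 := by
  simp only [rayPt, norm_mul, Complex.norm_real, Real.norm_of_nonneg (Real.sqrt_nonneg _), he,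
    mul_one, Real.sq_sqrt (show (0:ℝ) ≤ 1 - ĝ (c + (n : ℂ) * v) by linarith)]
  ring

/-- `Θᴮ` of a ray point: `(c + F v, e)` (`|v| = |e| = 1`, `n > 0`, `ĝ < 1`). [folklore] -/
theorem thetaB_rayPt {v e : ℂ} (hv : ‖v‖ = 1) (he : ‖e‖ = 1) {n : ℝ} (hn : 0 < n)
    (hg : ĝ (c + (n : ℂ) * v) < 1) :
    thetaB c ĝ χ (rayPt c ĝ v e n) = (c + ((profF c ĝ χ (rayPt c ĝ v e n) : ℝ) : ℂ) * v, e) := by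
  have hlev := level_rayPt (c := c) (ĝ := ĝ) (v := v) he hg.le
  have hs : 0 < Real.sqrt (1 - ĝ (c + (n : ℂ) * v)) := Real.sqrt_pos.2 (by linarith)
  rw [thetaB, hlev]
  simp only [rayPt, Complex.ofReal_one, one_mul]
  rw [unitDir_ray hv hn]
  congr 1
  have := unitDir_ray (c := 0) he hs
  rwa [zero_add] at this

/-- **The compression sweep (intermediate value theorem along the hypersurface)**: along the ray
of the unit vector `v`, between radii `n₁ ≤ n₂` of the annulus at which `ĝ < 1` and
`ĝ > 1 − m₀²`, the profile of the ray points takes every intermediate value `f`; the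
corresponding point `(c + f v, e)` is then in the image of the punctured collar under `Θᴮ`.
[folklore] -/
theorem mem_image_thetaB_of_ivt (ha : 0 ≤ a₁) (hχs : ContDiff ℝ ∞ χ)
    (hrad : ∀ v : ℂ, ‖v‖ = 1 → ∀ r, a₁ < r → r < a₂ →
      ∃ d < 0, HasDerivAt (fun r : ℝ ↦ ĝ (c + (r : ℂ) * v)) d r)
    {v e : ℂ} (hv : ‖v‖ = 1) (he : ‖e‖ = 1) {n₁ n₂ : ℝ} (h1 : a₁ < n₁) (h12 : n₁ ≤ n₂)
    (h2 : n₂ < a₂) (hg1 : ĝ (c + (n₁ : ℂ) * v) < 1) (hg2 : 1 - m₀ ^ 2 < ĝ (c + (n₂ : ℂ) * v))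
    (hm₀ : 0 < m₀) {f : ℝ} (hf1 : profF c ĝ χ (rayPt c ĝ v e n₁) ≤ f)
    (hf2 : f ≤ profF c ĝ χ (rayPt c ĝ v e n₂)) :
    (c + (f : ℂ) * v, e) ∈ thetaB c ĝ χ '' collarB c a₁ a₂ m₀ := by
  have hmono := strictAntiOn_ray hrad hv
  -- continuity of the profile along the ray
  have hgc : ∀ n ∈ Icc n₁ n₂, ContinuousAt (fun n : ℝ ↦ ĝ (c + (n : ℂ) * v)) n := fun n hn ↦
    (hrad v hv n (by linarith [hn.1]) (by linarith [hn.2])).choose_spec.2.continuousAt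
  have hcont : ContinuousOn (fun n : ℝ ↦ profF c ĝ χ (rayPt c ĝ v e n)) (Icc n₁ n₂) := by
    intro n hn
    have hg := hgc n hn
    have hχc : ContinuousAt (fun n : ℝ ↦ χ (ĝ (c + (n : ℂ) * v))) n :=
      hχs.continuous.continuousAt.comp hg
    have hsq : ContinuousAt (fun n : ℝ ↦ Real.sqrt (1 - ĝ (c + (n : ℂ) * v))) n :=
      Real.continuous_sqrt.continuousAt.comp (continuousAt_const.sub hg)
    have hWc : ContinuousAt (fun n : ℝ ↦ (Complex.ofReal (Real.sqrt (1 - ĝ (c + (n : ℂ) * v)))) * e) n :=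
      (Complex.continuous_ofReal.continuousAt.comp hsq).mul continuousAt_const
    have hw : ContinuousAt (fun n : ℝ ↦ norm ((Complex.ofReal (Real.sqrt (1 - ĝ (c + (n : ℂ) * v)))) * e)) n :=
      continuous_norm.continuousAt.comp hWc
    have hz : ContinuousAt (fun n : ℝ ↦ norm (c + (n : ℂ) * v - c)) n := by fun_prop
    have h : ContinuousAt (fun n : ℝ ↦ χ (ĝ (c + (n : ℂ) * v)) *
        thinRad (norm ((Complex.ofReal (Real.sqrt (1 - ĝ (c + (n : ℂ) * v)))) * e)) +
        (1 - χ (ĝ (c + (n : ℂ) * v))) * norm (c + (n : ℂ) * v - c)) n :=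
      (hχc.mul (continuous_thinRad.continuousAt.comp hw)).add
        ((continuousAt_const.sub hχc).mul hz)
    exact h.continuousWithinAt
  obtain ⟨n, hn, hfn⟩ := intermediate_value_Icc h12 hcont ⟨hf1, hf2⟩
  have hn0 : 0 < n := by linarith [hn.1]
  -- the ray point is in the punctured collar
  have hna : a₁ < n := by linarith [hn.1]
  have hnb : n < a₂ := by linarith [hn.2]
  have hgn1 : ĝ (c + (n : ℂ) * v) < 1 := by
    rcases hn.1.eq_or_lt with h | h
    · rw [← h]; exact hg1
    · exact (hmono ⟨h1, by linarith [hn.2]⟩ ⟨hna, hnb⟩ h).trans hg1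
  have hgn2 : 1 - m₀ ^ 2 < ĝ (c + (n : ℂ) * v) := by
    rcases hn.2.eq_or_lt with h | h
    · rw [h]; exact hg2
    · exact hg2.trans (hmono ⟨hna, hnb⟩ ⟨by linarith [hn.1], h2⟩ h)
  have hs : 0 < Real.sqrt (1 - ĝ (c + (n : ℂ) * v)) := Real.sqrt_pos.2 (by linarith)
  refine ⟨rayPt c ĝ v e n, ⟨⟨?_, ?_⟩, ?_, ?_⟩, ?_⟩
  · show a₁ < ‖c + (n : ℂ) * v - c‖
    rw [add_sub_cancel_left, norm_mul, Complex.norm_real, hv, mul_one, Real.norm_of_nonneg hn0.le]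
    linarith [hn.1]
  · show ‖c + (n : ℂ) * v - c‖ < a₂
    rw [add_sub_cancel_left, norm_mul, Complex.norm_real, hv, mul_one, Real.norm_of_nonneg hn0.le]
    linarith [hn.2]
  · exact mul_ne_zero (by exact_mod_cast hs.ne') (by rw [← norm_ne_zero_iff, he]; norm_num)
  · show norm ((Complex.ofReal (Real.sqrt (1 - ĝ (c + (n : ℂ) * v)))) * e) < m₀
    rw [norm_mul, Complex.norm_real, he, mul_one, Real.norm_of_nonneg hs.le,
      Real.sqrt_lt' hm₀]
    linarith
  · have hfn' : profF c ĝ χ (rayPt c ĝ v e n) = f := hfn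
    rw [thetaB_rayPt hv he hn0 hgn1, hfn']

end MMSW

end Literature.Topology.FourManifolds
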